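import Summits.AnomalousDissipation.AnomalousDissipation.Theorems.SawtoothPulseCascadeK1LocalisedCascadeCanonicalRatioStepsOsc
import Summits.AnomalousDissipation.AnomalousDissipation.Theorems.SawtoothPulseCascadeK1LocalisedCascadeCanonicalBlocksMax

/-!
# K1loc — THE SHELL-CHAIN STEPS (A-V), (B-H) AT AN ARBITRARY THRESHOLD, OSCILLATORY GRADE (numeric layer)

Prover lane on the crux `K1LocalisedCascade` (stmt-AnomalousDissipation-19491), route `SawtoothPulseCascade`
(S-B/S-C assembly seat; the LEDGER ASSEMBLY, numeric layer, Osc grade; companions of `…PhaseAV` / `…PhaseBH`).  Shape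
`γ = 8, d = 2, N₀ = 1, ρ_N = 2`, threshold `Y ≥ 12`, phase `i`, over ad-sawtooth-k1loc-p1's OSCILLATORY window blocks:
* (A-V) `shell_vstep_osc_le`: `A_{i+1}(Y) = Σ'[Y ≤ |k₀| ∧ |k₀| ≤ 2|k₁|]‖𝓕a_{i+1}‖² ≤ (√J_A + √B_i(Y))² + ((1+γ)^{2(i+1)}/(⌊Y/2⌋2^{7i+20}))²`,
  fibre floor `⌊Y/2⌋`, margin `4`, `max`-cut-offs `t = 2`, `Y₀ = Y − 1`; `r* = 37/11`, `A* = 7`, `D₀ = 2⌊Y/2⌋`,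
  `J_A = 3(37/11)²((4/3)ε² + (4/3)(2·2^i/(πD₀))² + 56·2^i/(πD₀) + (7i+20)(392·2^i√(4Mδ_i/(πD₀)) + 392Mδ_i/π))`;
* (B-H) `shallow_hstep_osc_le`: `B_i(Y) = Σ'[Y ≤ |k₀| ∧ |k₁| ≤ 2|k₀|]‖𝓕b_i‖² ≤ (√J_B + √A_i(Y))² + ((1+γ)^{2i}/(Y2^{7i+20}))²`,
  fibre floor `Y`, margin `3`, `t = 1`; `r* = 49/23`, `A* = 13/3`, `D₀ = 3Y`,
  `J_B = 3(49/23)²((4/3)ε² + (4/3)(2·2^i/(πD₀))² + 8·2^i(13/3)/(πD₀) + (7i+20)(8·2^i(13/3)²√(4Mδ_i/(πD₀)) + 8(13/3)²Mδ_i/π))`.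
Rounding targets `η_A = (ε/(7·8π·2^20·⌊Y/2⌋))·64^{−i}`, `η_B = (ε/((13/3)·8π·2^20·Y))·64^{−i}`; `Mδ_i = max(1,√(2log(1/η)))·δ_i`.
No definitions; no statement about the crux. [cite: Grafakos2014, Prop. 3.1.2 (5), Prop. 3.2.7 (3), §3.1.3] [problem: turb]
-/

-- `Summit.<Summit>.<Problem>`: single-conjunct summit, the duplicate namespace segment is deliberate.
set_option linter.dupNamespace false

noncomputable section

namespace Summit.AnomalousDissipation.AnomalousDissipation.Theorems.SawtoothPulseCascade.K1Window

open MeasureTheory Set Filter Topology UnitAddTorus Function Complex Metric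
open scoped Real ENNReal
open Literature.Analysis Literature.Analysis.FunctionSpaces Literature.Analysis.FunctionSpaces.Torus Literature.Analysis.FluidPDE
open Literature.Analysis.FluidPDE.ShearStage
open Literature.Analysis.FluidPDE.SawtoothCascade Literature.Analysis.FluidPDE.SawtoothCascade.CascadeParams
open Summit.AnomalousDissipation.AnomalousDissipation.Theorems.SawtoothPulseCascade.K1Start
open Summit.AnomalousDissipation.AnomalousDissipation.Theorems.SawtoothPulseCascade.K1Flat
open Summit.AnomalousDissipation.AnomalousDissipation.Theorems.SawtoothPulseCascade.K1Ledger.From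

/-- **The plain cut-off ratio of the (A-V) blocks** (max family, `t = 2` with `Y₀ ≤ 2Λ₀`, `β = 4`, `Λ₀ ≥ 6`): `r_m ≤ 37/11`.
[folklore] -/
theorem av_cutoff_le {Λ0 Y₀ : ℕ} (hΛ0 : 6 ≤ Λ0) (hY₀ : Y₀ * 1 ≤ 2 * Λ0) (m : ℕ) :
    (((max (2 * 1 * (Λ0 * 2 ^ m) / 2) Y₀ : ℕ) : ℝ) + ((4 * (Λ0 * 2 ^ m) / 1 : ℕ) : ℝ)) /
        (((4 * (Λ0 * 2 ^ m) / 1 : ℕ) : ℝ) - ((max (2 * 1 * (Λ0 * 2 ^ m) / 2) Y₀ : ℕ) : ℝ)) ≤ 37 / 11 := by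
  have h1 : 2 * 1 * 1 ≤ 2 * 2 := by norm_num
  have h3 : 2 * 1 * Λ0 + 2 * 1 * 1 ≤ 4 * 1 * Λ0 := by omega
  have hr := canonMax_r_le (u' := 1) (v' := 2) (Y₀ := Y₀) (tn := 2) (td := 1) (qn := 4) (qd := 1) (Λ0 := Λ0)
    (by norm_num) (by norm_num) (by norm_num) h1 hY₀ h3 m
  have hΛ0r : (6 : ℝ) ≤ Λ0 := by exact_mod_cast hΛ0
  have hden : (0 : ℝ) < (((4 : ℕ) : ℝ) / ((1 : ℕ) : ℝ) - ((2 : ℕ) : ℝ) / ((1 : ℕ) : ℝ)) * (Λ0 : ℝ) - 1 := by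
    push_cast; linarith
  have hrs : ((((2 : ℕ) : ℝ) / ((1 : ℕ) : ℝ) + ((4 : ℕ) : ℝ) / ((1 : ℕ) : ℝ)) * (Λ0 : ℝ) + 1) /
      ((((4 : ℕ) : ℝ) / ((1 : ℕ) : ℝ) - ((2 : ℕ) : ℝ) / ((1 : ℕ) : ℝ)) * (Λ0 : ℝ) - 1) ≤ 37 / 11 := by
    rw [div_le_iff₀ hden]
    push_cast; linarith
  exact hr.trans hrs

/-- **The plain cut-off ratio of the (B-H) blocks** (max family, `t = 1`, `Y₀ = 0`, `β = 3`, `Λ₀ ≥ 12`): `r_m ≤ 49/23`. [folklore] -/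
theorem bh_cutoff_le {Y : ℕ} (hY : 12 ≤ Y) (m : ℕ) :
    (((max (2 * 1 * (Y * 2 ^ m) / 2) 0 : ℕ) : ℝ) + ((3 * (Y * 2 ^ m) / 1 : ℕ) : ℝ)) /
        (((3 * (Y * 2 ^ m) / 1 : ℕ) : ℝ) - ((max (2 * 1 * (Y * 2 ^ m) / 2) 0 : ℕ) : ℝ)) ≤ 49 / 23 := by
  have h1 : 2 * 1 * 1 ≤ 1 * 2 := by norm_num
  have h2 : 0 * 1 ≤ 1 * Y := by simp
  have h3 : 1 * 1 * Y + 2 * 1 * 1 ≤ 3 * 1 * Y := by omega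
  have hr := canonMax_r_le (u' := 1) (v' := 2) (Y₀ := 0) (tn := 1) (td := 1) (qn := 3) (qd := 1) (Λ0 := Y)
    (by norm_num) (by norm_num) (by norm_num) h1 h2 h3 m
  have hYr : (12 : ℝ) ≤ Y := by exact_mod_cast hY
  have hden : (0 : ℝ) < (((3 : ℕ) : ℝ) / ((1 : ℕ) : ℝ) - ((1 : ℕ) : ℝ) / ((1 : ℕ) : ℝ)) * (Y : ℝ) - 1 := by
    push_cast; linarith
  have hrs : ((((1 : ℕ) : ℝ) / ((1 : ℕ) : ℝ) + ((3 : ℕ) : ℝ) / ((1 : ℕ) : ℝ)) * (Y : ℝ) + 1) /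
      ((((3 : ℕ) : ℝ) / ((1 : ℕ) : ℝ) - ((1 : ℕ) : ℝ) / ((1 : ℕ) : ℝ)) * (Y : ℝ) - 1) ≤ 49 / 23 := by
    rw [div_le_iff₀ hden]
    push_cast; linarith
  exact hr.trans hrs

section Cascade

variable (P : CascadeParams)

set_option maxHeartbeats 400000 in
/-- **(A-V) AT THRESHOLD `Y ≥ 12`, PHASE `i`, OSCILLATORY GRADE** (see the file header).
[cite: Grafakos2014, Prop. 3.1.2 (5), Prop. 3.2.7 (3), §3.1.3] -/
theorem shell_vstep_osc_le (hγ : P.γ = 8) (hδ₀ : 0 < P.δ₀) (hd : P.d = 2) (hN₀ : P.N₀ = 1) (hρN : P.ρN = 2)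
    (a b : ℕ → UnitAddTorus (Fin 2) → ℝ) (has : ∀ j, IsSmooth (a j)) (h0 : a 0 = datum)
    (hb : ∀ j, b j = a j ∘ shearMap 0 1 (amp ⟨P.U j, P.U_periodic j, P.contDiff_U (P.δ_pos hδ₀ (by rw [hd]; norm_num) j)⟩ P.γ))
    (hab : ∀ j, a (j + 1) = b j ∘ shearMap 1 0 (amp ⟨P.U j, P.U_periodic j, P.contDiff_U (P.δ_pos hδ₀ (by rw [hd]; norm_num) j)⟩ P.γ))
    {Y : ℕ} (hY : 12 ≤ Y) {ε : ℝ} (hε : 0 < ε) (i : ℕ)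
    (hMδ : max 1 (Real.sqrt (2 * Real.log (1 / (ε / (7 * π * 8 * 2 ^ 20 * ((Y / 2 : ℕ) : ℝ)) * (1 / 64) ^ i)))) * P.δ i < π / 2) :
    ∑' k : Fin 2 → ℤ, (if (Y : ℤ) ≤ |k 0| ∧ ((1 : ℕ) : ℤ) * |k 0| ≤ ((2 : ℕ) : ℤ) * |k 1| then (1 : ℝ) else 0) *
        ‖mFourierCoeff (fun x => (a (i + 1) x : ℂ)) k‖ ^ 2 ≤
      (Real.sqrt (3 * (37 / 11) ^ 2 *
            (4 / 3 * ε ^ 2 + 4 / 3 * (2 * 2 ^ i / (π * (2 * ((Y / 2 : ℕ) : ℝ)))) ^ 2 + 8 * 2 ^ i * 7 / (π * (2 * ((Y / 2 : ℕ) : ℝ))) +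
              ((7 * i + 20 : ℕ) : ℝ) * (8 * 2 ^ i * 7 ^ 2 *
                Real.sqrt (4 * (max 1 (Real.sqrt (2 * Real.log (1 / (ε / (7 * π * 8 * 2 ^ 20 * ((Y / 2 : ℕ) : ℝ)) * (1 / 64) ^ i)))) * P.δ i) / (π * (2 * ((Y / 2 : ℕ) : ℝ)))) +
                8 * 7 ^ 2 * (max 1 (Real.sqrt (2 * Real.log (1 / (ε / (7 * π * 8 * 2 ^ 20 * ((Y / 2 : ℕ) : ℝ)) * (1 / 64) ^ i)))) * P.δ i) / π))) +
          Real.sqrt (∑' k : Fin 2 → ℤ, (if (Y : ℤ) ≤ |k 0| ∧ ((1 : ℕ) : ℤ) * |k 1| ≤ ((2 : ℕ) : ℤ) * |k 0| then (1 : ℝ) else 0) *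
            ‖mFourierCoeff (fun x => (b i x : ℂ)) k‖ ^ 2)) ^ 2 +
        ((1 + P.γ) ^ (2 * (i + 1)) / (((Y / 2) * 2 ^ (7 * i + 20) : ℕ) : ℝ)) ^ 2 := by
  have hΛ06 : 6 ≤ Y / 2 := by omega
  have hΛ01 : 1 ≤ Y / 2 := le_trans (by norm_num) hΛ06
  have hΛ0r : (6 : ℝ) ≤ ((Y / 2 : ℕ) : ℝ) := by exact_mod_cast hΛ06
  have hΛ0pos : (0 : ℝ) < ((Y / 2 : ℕ) : ℝ) := by linarith
  have hγ' : P.γ = ((8 : ℕ) : ℝ) := by rw [hγ]; norm_num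
  have hd' : 0 < P.d := by rw [hd]; norm_num
  have hN₀' : 1 ≤ P.N₀ := by rw [hN₀]
  have hρN' : 1 ≤ P.ρN := by rw [hρN]; norm_num
  have hNi : (P.N i : ℝ) = 2 ^ i := by rw [CascadeParams.N, hN₀, hρN]; push_cast; ring
  have hΛX : 2 * (Y / 2) ≤ 1 * Y := by omega
  have h1 : 2 * 1 * 1 ≤ 2 * 2 := by norm_num
  have h2 : (Y - 1) * 1 ≤ 2 * (Y / 2) := by omega
  have h3 : 2 * 1 * (Y / 2) + 2 * 1 * 1 ≤ 4 * 1 * (Y / 2) := by omega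
  set η : ℝ := (ε / (7 * π * 8 * 2 ^ 20 * ((Y / 2 : ℕ) : ℝ)) * (1 / 64) ^ i) with hη
  have hπ := Real.pi_pos
  have hηpos : 0 < η := by rw [hη]; positivity
  have hstep := ratioClass_vstep_canonicalOsc_le P hγ' hδ₀ hd' hN₀' hρN' a b has h0 hb hab i (u := 1) (v := 2) (X := Y)
    (u' := 1) (v' := 2) (Y := Y) (qn := 4) (qd := 1) (Λ0 := Y / 2) (by norm_num) (by norm_num) (by norm_num) (by norm_num)
    (by norm_num) hΛ01 hΛX (fun m => max (2 * 1 * ((Y / 2) * 2 ^ m) / 2) (Y - 1))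
    (fun m => canonMax_Q₁_lt_Q₂ (by norm_num) (by norm_num) (by norm_num) h1 h2 h3 m)
    (fun m => canonMax_feed (by norm_num) (Y - 1) (Y / 2) m) (rs := 37 / 11) (fun m => av_cutoff_le hΛ06 h2 m)
    (fun m => le_trans (by omega) (canonMax_Y 1 2 (Y - 1) (Y / 2) m)) (7 * i + 20) hηpos hMδ
  -- the exact constants at `(u,v,q_n,q_d) = (1,2,4,1)`: `A* = 7`, `D₀ = 2⌊Y/2⌋`
  have eratio : ((((2 : ℕ) : ℝ) + ((1 : ℕ) : ℝ) * ((8 : ℕ) : ℝ)) * ((1 : ℕ) : ℝ) + ((1 : ℕ) : ℝ) * ((4 : ℕ) : ℝ)) /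
      ((((1 : ℕ) : ℝ) * ((8 : ℕ) : ℝ) - ((2 : ℕ) : ℝ)) * ((1 : ℕ) : ℝ) - ((1 : ℕ) : ℝ) * ((4 : ℕ) : ℝ)) = 7 := by
    push_cast; norm_num
  have eD : ((((1 : ℕ) : ℝ) * ((8 : ℕ) : ℝ) - ((2 : ℕ) : ℝ)) * ((1 : ℕ) : ℝ) - ((1 : ℕ) : ℝ) * ((4 : ℕ) : ℝ)) * ((Y / 2 : ℕ) : ℝ) /
      (((1 : ℕ) : ℝ) * ((1 : ℕ) : ℝ)) = 2 * ((Y / 2 : ℕ) : ℝ) := by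
    push_cast; ring
  refine le_sq_sqrt_add_mono hstep ?_
  rw [eratio, eD, hNi]
  have hX : (7 : ℝ) * π * ((8 : ℕ) : ℝ) * η * ((Y / 2 : ℕ) : ℝ) / 2 ^ i * 2 ^ (7 * i + 20) = ε := by
    have e2 : (2 : ℝ) ^ (7 * i + 20) = 2 ^ 20 * 128 ^ i := by
      rw [pow_add, pow_mul]; norm_num; ring
    have p1 : ((1 : ℝ) / 64) ^ i * (128 : ℝ) ^ i = (2 : ℝ) ^ i := by
      rw [← mul_pow]; norm_num
    have hne1 : (7 : ℝ) * Real.pi * 8 * 2 ^ 20 * ((Y / 2 : ℕ) : ℝ) ≠ 0 := by positivity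
    have hne2 : (2 : ℝ) ^ i ≠ 0 := pow_ne_zero _ two_ne_zero
    rw [hη, e2]
    push_cast
    calc (7 : ℝ) * π * 8 * (ε / (7 * π * 8 * 2 ^ 20 * ((Y / 2 : ℕ) : ℝ)) * (1 / 64) ^ i) * ((Y / 2 : ℕ) : ℝ) / 2 ^ i *
          (2 ^ 20 * 128 ^ i)
        = ε * (((7 : ℝ) * Real.pi * 8 * 2 ^ 20 * ((Y / 2 : ℕ) : ℝ)) / (7 * Real.pi * 8 * 2 ^ 20 * ((Y / 2 : ℕ) : ℝ))) *
            ((((1 : ℝ) / 64) ^ i * 128 ^ i) / 2 ^ i) := by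
          field_simp
      _ = ε := by rw [p1, div_self hne1, div_self hne2]; ring
  rw [hX]

set_option maxHeartbeats 400000 in
/-- **(B-H) AT THRESHOLD `Y ≥ 12`, PHASE `i`, OSCILLATORY GRADE** (see the file header).
[cite: Grafakos2014, Prop. 3.1.2 (5), Prop. 3.2.7 (3), §3.1.3] -/
theorem shallow_hstep_osc_le (hγ : P.γ = 8) (hδ₀ : 0 < P.δ₀) (hd : P.d = 2) (hN₀ : P.N₀ = 1) (hρN : P.ρN = 2)
    (a b : ℕ → UnitAddTorus (Fin 2) → ℝ) (has : ∀ j, IsSmooth (a j)) (h0 : a 0 = datum)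
    (hb : ∀ j, b j = a j ∘ shearMap 0 1 (amp ⟨P.U j, P.U_periodic j, P.contDiff_U (P.δ_pos hδ₀ (by rw [hd]; norm_num) j)⟩ P.γ))
    (hab : ∀ j, a (j + 1) = b j ∘ shearMap 1 0 (amp ⟨P.U j, P.U_periodic j, P.contDiff_U (P.δ_pos hδ₀ (by rw [hd]; norm_num) j)⟩ P.γ))
    {Y : ℕ} (hY : 12 ≤ Y) {ε : ℝ} (hε : 0 < ε) (i : ℕ)
    (hMδ : max 1 (Real.sqrt (2 * Real.log (1 / (ε / (13 / 3 * π * 8 * 2 ^ 20 * (Y : ℝ)) * (1 / 64) ^ i)))) * P.δ i < π / 2) :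
    ∑' k : Fin 2 → ℤ, (if (Y : ℤ) ≤ |k 0| ∧ ((1 : ℕ) : ℤ) * |k 1| ≤ ((2 : ℕ) : ℤ) * |k 0| then (1 : ℝ) else 0) *
        ‖mFourierCoeff (fun x => (b i x : ℂ)) k‖ ^ 2 ≤
      (Real.sqrt (3 * (49 / 23) ^ 2 *
            (4 / 3 * ε ^ 2 + 4 / 3 * (2 * 2 ^ i / (π * (3 * (Y : ℝ)))) ^ 2 + 8 * 2 ^ i * (13 / 3) / (π * (3 * (Y : ℝ))) +
              ((7 * i + 20 : ℕ) : ℝ) * (8 * 2 ^ i * (13 / 3) ^ 2 *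
                Real.sqrt (4 * (max 1 (Real.sqrt (2 * Real.log (1 / (ε / (13 / 3 * π * 8 * 2 ^ 20 * (Y : ℝ)) * (1 / 64) ^ i)))) * P.δ i) / (π * (3 * (Y : ℝ)))) +
                8 * (13 / 3) ^ 2 * (max 1 (Real.sqrt (2 * Real.log (1 / (ε / (13 / 3 * π * 8 * 2 ^ 20 * (Y : ℝ)) * (1 / 64) ^ i)))) * P.δ i) / π))) +
          Real.sqrt (∑' k : Fin 2 → ℤ, (if (Y : ℤ) ≤ |k 0| ∧ ((1 : ℕ) : ℤ) * |k 0| ≤ ((2 : ℕ) : ℤ) * |k 1| then (1 : ℝ) else 0) *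
            ‖mFourierCoeff (fun x => (a i x : ℂ)) k‖ ^ 2)) ^ 2 +
        ((1 + P.γ) ^ (2 * i) / ((Y * 2 ^ (7 * i + 20) : ℕ) : ℝ)) ^ 2 := by
  have hY1 : 1 ≤ Y := le_trans (by norm_num) hY
  have hYr : (12 : ℝ) ≤ Y := by exact_mod_cast hY
  have hYpos : (0 : ℝ) < Y := by linarith
  have hγ' : P.γ = ((8 : ℕ) : ℝ) := by rw [hγ]; norm_num
  have hd' : 0 < P.d := by rw [hd]; norm_num
  have hN₀' : 1 ≤ P.N₀ := by rw [hN₀]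
  have hρN' : 1 ≤ P.ρN := by rw [hρN]; norm_num
  have hNi : (P.N i : ℝ) = 2 ^ i := by rw [CascadeParams.N, hN₀, hρN]; push_cast; ring
  have h1 : 2 * 1 * 1 ≤ 1 * 2 := by norm_num
  have h2 : 0 * 1 ≤ 1 * Y := by simp
  have h3 : 1 * 1 * Y + 2 * 1 * 1 ≤ 3 * 1 * Y := by omega
  set η : ℝ := (ε / (13 / 3 * π * 8 * 2 ^ 20 * (Y : ℝ)) * (1 / 64) ^ i) with hη
  have hπ := Real.pi_pos
  have hηpos : 0 < η := by rw [hη]; positivity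
  have hstep := ratioClass_hstep_canonicalOsc_le P hγ' hδ₀ hd' hN₀' hρN' a b has h0 hb hab i (u := 1) (v := 2)
    (u' := 1) (v' := 2) (Y := Y) (qn := 3) (qd := 1) (Λ0 := Y) (by norm_num) (by norm_num) (by norm_num) (by norm_num)
    (by norm_num) hY1 le_rfl (fun m => max (2 * 1 * (Y * 2 ^ m) / 2) 0)
    (fun m => canonMax_Q₁_lt_Q₂ (by norm_num) (by norm_num) (by norm_num) h1 h2 h3 m)
    (fun m => canonMax_feed (by norm_num) 0 Y m) (rs := 49 / 23) (fun m => bh_cutoff_le hY m) (7 * i + 20) hηpos hMδ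
  -- the exact constants at `(u,v,q_n,q_d) = (1,2,3,1)`: `A* = 13/3`, `D₀ = 3Y`
  have eratio : ((((2 : ℕ) : ℝ) + ((1 : ℕ) : ℝ) * ((8 : ℕ) : ℝ)) * ((1 : ℕ) : ℝ) + ((1 : ℕ) : ℝ) * ((3 : ℕ) : ℝ)) /
      ((((1 : ℕ) : ℝ) * ((8 : ℕ) : ℝ) - ((2 : ℕ) : ℝ)) * ((1 : ℕ) : ℝ) - ((1 : ℕ) : ℝ) * ((3 : ℕ) : ℝ)) = 13 / 3 := by
    push_cast; norm_num
  have eD : ((((1 : ℕ) : ℝ) * ((8 : ℕ) : ℝ) - ((2 : ℕ) : ℝ)) * ((1 : ℕ) : ℝ) - ((1 : ℕ) : ℝ) * ((3 : ℕ) : ℝ)) * (Y : ℝ) /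
      (((1 : ℕ) : ℝ) * ((1 : ℕ) : ℝ)) = 3 * (Y : ℝ) := by
    push_cast; ring
  refine le_sq_sqrt_add_mono hstep ?_
  rw [eratio, eD, hNi]
  have hX : (13 / 3 : ℝ) * π * ((8 : ℕ) : ℝ) * η * (Y : ℝ) / 2 ^ i * 2 ^ (7 * i + 20) = ε := by
    have e2 : (2 : ℝ) ^ (7 * i + 20) = 2 ^ 20 * 128 ^ i := by
      rw [pow_add, pow_mul]; norm_num; ring
    have p1 : ((1 : ℝ) / 64) ^ i * (128 : ℝ) ^ i = (2 : ℝ) ^ i := by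
      rw [← mul_pow]; norm_num
    have hne1 : (13 / 3 : ℝ) * Real.pi * 8 * 2 ^ 20 * (Y : ℝ) ≠ 0 := by positivity
    have hne2 : (2 : ℝ) ^ i ≠ 0 := pow_ne_zero _ two_ne_zero
    rw [hη, e2]
    push_cast
    calc (13 / 3 : ℝ) * π * 8 * (ε / (13 / 3 * π * 8 * 2 ^ 20 * (Y : ℝ)) * (1 / 64) ^ i) * (Y : ℝ) / 2 ^ i * (2 ^ 20 * 128 ^ i)
        = ε * (((13 / 3 : ℝ) * Real.pi * 8 * 2 ^ 20 * (Y : ℝ)) / (13 / 3 * Real.pi * 8 * 2 ^ 20 * (Y : ℝ))) *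
            ((((1 : ℝ) / 64) ^ i * 128 ^ i) / 2 ^ i) := by
          field_simp
      _ = ε := by rw [p1, div_self hne1, div_self hne2]; ring
  rw [hX]

end Cascade

end Summit.AnomalousDissipation.AnomalousDissipation.Theorems.SawtoothPulseCascade.K1Window
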